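import Literature.NumberTheory.EllipticCurves.ModularSymbolsManinGeneration
import HarnessLib

/-!
# The involution `ι = diag(−1, 1)` on modular symbols and the `±`-parts

The matrix `ι = diag(−1, 1)` (complex conjugation on the modular curve, `r ↦ −r` on cusps)
normalises `Γ₀(N)` (`iotaConj`, `iotaMat_mul_eq`: `ι γ = (ιγι) ι` with `ιγι = (a, −b; −c, d)`), so
`φ ↦ φ|ι` preserves `Symb_{Γ₀(N)}(V)` for every coefficient system containing `ι`
(`slash_iota_mem_Symb`), and it **commutes with the Hecke operators `T_p` / `U_p`**
(`hecke_slash_iota`): `ι βⱼ = T⁻¹ β_{−j} ι` for `j ≠ 0`, `ι β₀ = β₀ ι`, `ι δ = δ ι`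
(`iotaMat_mul_heckeRep_some`, `iotaMat_mul_heckeRep_none`).  Hence the `±`-parts
`φ^± = φ ± φ|ι` of a Hecke eigensymbol are Hecke eigensymbols with the same eigenvalues
(`plusPart`, `minusPart`, `hecke_plusPart`, `hecke_minusPart`) — the decomposition of
Mazur–Tate–Teitelbaum 1986, §I.8 / Cremona 1997, §2.1.3 used to isolate the real periods `Ω^±`.

Everything is proved; no named facts.

## References

* B. Mazur, J. Tate, J. Teitelbaum, Invent. Math. 84 (1986), §I.8. [MazurTateTeitelbaum1986Invent]
* J. E. Cremona, *Algorithms for modular elliptic curves* (1997), §2.1.3. [CremonaAlgorithms1997]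
-/

noncomputable section

open scoped MatrixGroups
open Matrix CongruenceSubgroup

namespace Literature.NumberTheory.EllipticCurves

open ModularForms ModularForms.HidaCohomology

/-! ### The matrix `ι` and its conjugation action on `Γ₀(N)` -/

/-- `ι = diag(−1, 1)`. [cite: MazurTateTeitelbaum1986Invent, §I.8] -/
def iotaMat : Matrix (Fin 2) (Fin 2) ℤ := !![-1, 0; 0, 1]

/-- Entry `(0,0)` of `ι`. [folklore] -/
@[simp] theorem iotaMat_apply00 : iotaMat 0 0 = -1 := rfl
/-- Entry `(0,1)` of `ι`. [folklore] -/
@[simp] theorem iotaMat_apply01 : iotaMat 0 1 = 0 := rfl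
/-- Entry `(1,0)` of `ι`. [folklore] -/
@[simp] theorem iotaMat_apply10 : iotaMat 1 0 = 0 := rfl
/-- Entry `(1,1)` of `ι`. [folklore] -/
@[simp] theorem iotaMat_apply11 : iotaMat 1 1 = 1 := rfl

/-- `det ι = −1`. [folklore] -/
theorem det_iotaMat : iotaMat.det = -1 := by
  rw [iotaMat, Matrix.det_fin_two_of]; ring

/-- `det ι ≠ 0`. [folklore] -/
theorem det_iotaMat_ne_zero : iotaMat.det ≠ 0 := by rw [det_iotaMat]; decide

/-- `ι² = 1`. [folklore] -/
theorem iotaMat_mul_iotaMat : iotaMat * iotaMat = 1 := by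
  rw [iotaMat]
  ext i j
  fin_cases i <;> fin_cases j <;> simp [Matrix.mul_apply, Fin.sum_univ_two]

/-- **`ι γ ι = (a, −b; −c, d) ∈ SL(2, ℤ)`.** [folklore] -/
def iotaConj (γ : SL(2, ℤ)) : SL(2, ℤ) :=
  ⟨!![γ 0 0, -γ 0 1; -γ 1 0, γ 1 1], by
    rw [Matrix.det_fin_two_of]
    have hdet := Matrix.det_fin_two (γ : Matrix (Fin 2) (Fin 2) ℤ)
    rw [Matrix.SpecialLinearGroup.det_coe] at hdet
    linear_combination -hdet⟩

/-- Entries of `iotaConj`. [folklore] -/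
theorem coe_iotaConj (γ : SL(2, ℤ)) : (iotaConj γ : Matrix (Fin 2) (Fin 2) ℤ) = !![γ 0 0, -γ 0 1; -γ 1 0, γ 1 1] := rfl

/-- **`ι γ = (ι γ ι) ι`.** [folklore] -/
theorem iotaMat_mul_eq (γ : SL(2, ℤ)) : iotaMat * (γ : Matrix (Fin 2) (Fin 2) ℤ) = (iotaConj γ : Matrix (Fin 2) (Fin 2) ℤ) * iotaMat := by
  rw [coe_iotaConj, iotaMat]
  ext i j
  fin_cases i <;> fin_cases j <;> simp [Matrix.mul_apply, Fin.sum_univ_two]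

/-- `ι γ ι ∈ Γ₀(N)` for `γ ∈ Γ₀(N)`. [folklore] -/
theorem iotaConj_mem_gamma0 {N : ℕ} {γ : SL(2, ℤ)} (hγ : γ ∈ Gamma0 N) : iotaConj γ ∈ Gamma0 N := by
  rw [Gamma0_mem] at hγ ⊢
  change (((-γ 1 0 : ℤ)) : ZMod N) = 0
  rw [Int.cast_neg, hγ, neg_zero]

/-! ### `ι` and the Hecke matrices -/

/-- `ι δ = δ ι` for `δ = diag(p, 1)`. [folklore] -/
theorem iotaMat_mul_heckeRep_none (p : ℕ) : iotaMat * heckeRep p none = heckeRep p none * iotaMat := by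
  rw [iotaMat, heckeRep]
  ext i j
  fin_cases i <;> fin_cases j <;> simp [Matrix.mul_apply, Fin.sum_univ_two]

/-- **`ι βⱼ = T^t β_{−j} ι`** with `t = −1` if `j ≠ 0` and `t = 0` if `j = 0` (so that
`(−j).val + t p = −j.val`). [folklore] -/
theorem iotaMat_mul_heckeRep_some {p : ℕ} [NeZero p] (j : ZMod p) :
    ∃ t : ℤ, iotaMat * heckeRep p (some j) =
      ((ModularGroup.T ^ t : SL(2, ℤ)) : Matrix (Fin 2) (Fin 2) ℤ) * (heckeRep p (some (-j)) * iotaMat) := by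
  -- the translation exponent
  have hval : ∃ t : ℤ, ((-j).val : ℤ) + t * p = -(j.val : ℤ) := by
    by_cases hj : j = 0
    · exact ⟨0, by rw [hj, neg_zero, ZMod.val_zero]; simp⟩
    · refine ⟨-1, ?_⟩
      rw [ZMod.neg_val, if_neg hj, Nat.cast_sub (ZMod.val_lt j).le]
      ring
  obtain ⟨t, ht⟩ := hval
  refine ⟨t, ?_⟩
  rw [ModularGroup.coe_T_zpow, iotaMat, heckeRep, heckeRep]
  ext i l
  fin_cases i <;> fin_cases l <;> simp [Matrix.mul_apply, Fin.sum_univ_two, -ZMod.natCast_val]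
  linear_combination -ht

namespace CoeffActionOn

variable {S : Set (Matrix (Fin 2) (Fin 2) ℤ)} {R V : Type*} [CommRing R] [AddCommGroup V] [Module R V]
  (A : CoeffActionOn S R V) (hS : ∀ M ∈ S, ∀ M' ∈ S, M * M' ∈ S) {N : ℕ}

/-- **`φ|ι ∈ Symb_{Γ₀(N)}`** for `φ ∈ Symb_{Γ₀(N)}` (`ι` normalises `Γ₀(N)`). [cite: MazurTateTeitelbaum1986Invent, §I.8] -/
theorem slash_iota_mem_Symb (hι : iotaMat ∈ S) (hΓ : ∀ γ : SL(2, ℤ), γ ∈ Gamma0 N → (γ : Matrix (Fin 2) (Fin 2) ℤ) ∈ S)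
    {φ : P1Q → P1Q → V} (hφ : φ ∈ A.Symb (Gamma0 N)) : A.slash iotaMat φ ∈ A.Symb (Gamma0 N) := by
  refine ⟨A.slash_mem_modSym _ hφ.1, fun γ hγ => ?_⟩
  have hdetγ : (γ : Matrix (Fin 2) (Fin 2) ℤ).det ≠ 0 := by rw [Matrix.SpecialLinearGroup.det_coe]; exact one_ne_zero
  have hγ' : iotaConj γ ∈ Gamma0 N := iotaConj_mem_gamma0 hγ
  have hdetγ' : (iotaConj γ : Matrix (Fin 2) (Fin 2) ℤ).det ≠ 0 := by rw [Matrix.SpecialLinearGroup.det_coe]; exact one_ne_zero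
  rw [← LinearMap.comp_apply, ← A.slash_mul hι (hΓ γ hγ) det_iotaMat_ne_zero hdetγ, iotaMat_mul_eq γ,
    A.slash_mul (hΓ _ hγ') hι hdetγ' det_iotaMat_ne_zero, LinearMap.comp_apply, hφ.2 _ hγ']

include hS in
/-- `(φ|ι)|βⱼ = (φ|β_{−j})|ι` for `φ ∈ Symb_{Γ₀(N)}`. [folklore] -/
theorem slash_heckeRep_some_slash_iota {p : ℕ} [NeZero p] (hp : p ≠ 0) (hι : iotaMat ∈ S)
    (hΓ : ∀ γ : SL(2, ℤ), γ ∈ Gamma0 N → (γ : Matrix (Fin 2) (Fin 2) ℤ) ∈ S) (hβ : ∀ j : ZMod p, heckeRep p (some j) ∈ S)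
    {φ : P1Q → P1Q → V} (hφ : φ ∈ A.Symb (Gamma0 N)) (j : ZMod p) :
    A.slash (heckeRep p (some j)) (A.slash iotaMat φ) = A.slash iotaMat (A.slash (heckeRep p (some (-j))) φ) := by
  have hdetβ : ∀ i : ZMod p, (heckeRep p (some i)).det ≠ 0 := fun i => by rw [det_heckeRep]; exact_mod_cast hp
  obtain ⟨t, ht⟩ := iotaMat_mul_heckeRep_some j
  have hT : (ModularGroup.T ^ t : SL(2, ℤ)) ∈ Gamma0 N := by rw [Gamma0_mem]; simp [ModularGroup.coe_T_zpow]
  have hdetT : ((ModularGroup.T ^ t : SL(2, ℤ)) : Matrix (Fin 2) (Fin 2) ℤ).det ≠ 0 := by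
    rw [Matrix.SpecialLinearGroup.det_coe]; exact one_ne_zero
  have hmemβι : heckeRep p (some (-j)) * iotaMat ∈ S := hS _ (hβ _) _ hι
  have hdetβι : (heckeRep p (some (-j)) * iotaMat).det ≠ 0 := by
    rw [Matrix.det_mul]; exact mul_ne_zero (hdetβ _) det_iotaMat_ne_zero
  rw [← LinearMap.comp_apply, ← A.slash_mul hι (hβ j) det_iotaMat_ne_zero (hdetβ j), ht,
    A.slash_mul (hΓ _ hT) hmemβι hdetT hdetβι, LinearMap.comp_apply, hφ.2 _ hT,
    A.slash_mul (hβ _) hι (hdetβ _) det_iotaMat_ne_zero, LinearMap.comp_apply]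

include hS in
/-- **`T_p` / `U_p` commute with `(·)|ι` on `Symb_{Γ₀(N)}`.** [cite: MazurTateTeitelbaum1986Invent, §I.8] -/
theorem hecke_slash_iota {p : ℕ} [NeZero p] (hp : p ≠ 0) (hι : iotaMat ∈ S)
    (hΓ : ∀ γ : SL(2, ℤ), γ ∈ Gamma0 N → (γ : Matrix (Fin 2) (Fin 2) ℤ) ∈ S) (hβ : ∀ i : HeckeIdx N p, heckeRep p i.1 ∈ S)
    {φ : P1Q → P1Q → V} (hφ : φ ∈ A.Symb (Gamma0 N)) :
    A.hecke N p (A.slash iotaMat φ) = A.slash iotaMat (A.hecke N p φ) := by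
  have hβ' : ∀ j : ZMod p, heckeRep p (some j) ∈ S := fun j => hβ ⟨some j, fun h => absurd h (Option.some_ne_none j)⟩
  rw [A.hecke_apply, A.hecke_apply, sum_heckeIdx N p (fun i => A.slash (heckeRep p i) (A.slash iotaMat φ)),
    sum_heckeIdx N p (fun i => A.slash (heckeRep p i) φ), map_add, map_sum]
  congr 1
  · simp_rw [A.slash_heckeRep_some_slash_iota hS hp hι hΓ hβ' hφ]
    exact Fintype.sum_equiv (Equiv.neg (ZMod p)) _ _ fun j => rfl
  · by_cases hpN : p ∣ N
    · rw [if_pos hpN, if_pos hpN, map_zero]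
    · rw [if_neg hpN, if_neg hpN]
      have hδ : heckeRep p none ∈ S := hβ ⟨none, fun _ => hpN⟩
      have hdetδ : (heckeRep p none).det ≠ 0 := by rw [det_heckeRep]; exact_mod_cast hp
      rw [← LinearMap.comp_apply, ← A.slash_mul hι hδ det_iotaMat_ne_zero hdetδ, iotaMat_mul_heckeRep_none,
        A.slash_mul hδ hι hdetδ det_iotaMat_ne_zero, LinearMap.comp_apply]

/-! ### The `±`-parts -/

/-- **The plus part `φ⁺ = φ + φ|ι`.** [cite: MazurTateTeitelbaum1986Invent, §I.8] -/
def plusPart (φ : P1Q → P1Q → V) : P1Q → P1Q → V := φ + A.slash iotaMat φ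

/-- **The minus part `φ⁻ = φ − φ|ι`.** [cite: MazurTateTeitelbaum1986Invent, §I.8] -/
def minusPart (φ : P1Q → P1Q → V) : P1Q → P1Q → V := φ - A.slash iotaMat φ

/-- Unfolding `plusPart`. [folklore] -/
theorem plusPart_apply (φ : P1Q → P1Q → V) (x y : P1Q) :
    A.plusPart φ x y = φ x y + A.ρ iotaMat (φ (P1Q.act iotaMat x) (P1Q.act iotaMat y)) := rfl

/-- Unfolding `minusPart`. [folklore] -/
theorem minusPart_apply (φ : P1Q → P1Q → V) (x y : P1Q) :
    A.minusPart φ x y = φ x y - A.ρ iotaMat (φ (P1Q.act iotaMat x) (P1Q.act iotaMat y)) := rfl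

/-- `φ⁺ ∈ Symb_{Γ₀(N)}`. [folklore] -/
theorem plusPart_mem_Symb (hι : iotaMat ∈ S) (hΓ : ∀ γ : SL(2, ℤ), γ ∈ Gamma0 N → (γ : Matrix (Fin 2) (Fin 2) ℤ) ∈ S)
    {φ : P1Q → P1Q → V} (hφ : φ ∈ A.Symb (Gamma0 N)) : A.plusPart φ ∈ A.Symb (Gamma0 N) :=
  add_mem hφ (A.slash_iota_mem_Symb hι hΓ hφ)

/-- `φ⁻ ∈ Symb_{Γ₀(N)}`. [folklore] -/
theorem minusPart_mem_Symb (hι : iotaMat ∈ S) (hΓ : ∀ γ : SL(2, ℤ), γ ∈ Gamma0 N → (γ : Matrix (Fin 2) (Fin 2) ℤ) ∈ S)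
    {φ : P1Q → P1Q → V} (hφ : φ ∈ A.Symb (Gamma0 N)) : A.minusPart φ ∈ A.Symb (Gamma0 N) :=
  sub_mem hφ (A.slash_iota_mem_Symb hι hΓ hφ)

include hS in
/-- **`T_p φ⁺ = a φ⁺` if `T_p φ = a φ`.** [cite: MazurTateTeitelbaum1986Invent, §I.8] -/
theorem hecke_plusPart {p : ℕ} [NeZero p] (hp : p ≠ 0) (hι : iotaMat ∈ S)
    (hΓ : ∀ γ : SL(2, ℤ), γ ∈ Gamma0 N → (γ : Matrix (Fin 2) (Fin 2) ℤ) ∈ S) (hβ : ∀ i : HeckeIdx N p, heckeRep p i.1 ∈ S)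
    {φ : P1Q → P1Q → V} (hφ : φ ∈ A.Symb (Gamma0 N)) {a : R} (heig : A.hecke N p φ = a • φ) :
    A.hecke N p (A.plusPart φ) = a • A.plusPart φ := by
  rw [plusPart, map_add, A.hecke_slash_iota hS hp hι hΓ hβ hφ, heig, map_smul, smul_add]

include hS in
/-- **`T_p φ⁻ = a φ⁻` if `T_p φ = a φ`.** [cite: MazurTateTeitelbaum1986Invent, §I.8] -/
theorem hecke_minusPart {p : ℕ} [NeZero p] (hp : p ≠ 0) (hι : iotaMat ∈ S)
    (hΓ : ∀ γ : SL(2, ℤ), γ ∈ Gamma0 N → (γ : Matrix (Fin 2) (Fin 2) ℤ) ∈ S) (hβ : ∀ i : HeckeIdx N p, heckeRep p i.1 ∈ S)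
    {φ : P1Q → P1Q → V} (hφ : φ ∈ A.Symb (Gamma0 N)) {a : R} (heig : A.hecke N p φ = a • φ) :
    A.hecke N p (A.minusPart φ) = a • A.minusPart φ := by
  rw [minusPart, map_sub, A.hecke_slash_iota hS hp hι hΓ hβ hφ, heig, map_smul, smul_sub]

/-- `(φ|ι)|ι = φ` when `ι ∈ S`. [folklore] -/
theorem slash_iota_slash_iota (hι : iotaMat ∈ S) (φ : P1Q → P1Q → V) : A.slash iotaMat (A.slash iotaMat φ) = φ := by
  rw [← LinearMap.comp_apply, ← A.slash_mul hι hι det_iotaMat_ne_zero det_iotaMat_ne_zero, iotaMat_mul_iotaMat, A.slash_one,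
    LinearMap.id_apply]

/-- `φ⁺|ι = φ⁺`. [folklore] -/
theorem slash_iota_plusPart (hι : iotaMat ∈ S) (φ : P1Q → P1Q → V) : A.slash iotaMat (A.plusPart φ) = A.plusPart φ := by
  rw [plusPart, map_add, A.slash_iota_slash_iota hι, add_comm]

/-- `φ⁻|ι = −φ⁻`. [folklore] -/
theorem slash_iota_minusPart (hι : iotaMat ∈ S) (φ : P1Q → P1Q → V) : A.slash iotaMat (A.minusPart φ) = -A.minusPart φ := by
  rw [minusPart, map_sub, A.slash_iota_slash_iota hι, neg_sub]

end CoeffActionOn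

/-! ### `ι` on cusps -/

/-- `ι · ∞ = ∞`. [folklore] -/
theorem P1Q.act_iotaMat_infty : P1Q.act iotaMat P1Q.infty = P1Q.infty :=
  P1Q.mat2_act_infty_of_eq_zero (a := -1) (b := 0) (d := 1) (by decide)

/-- `ι · r = −r`. [folklore] -/
theorem P1Q.act_iotaMat_ofRat (r : ℚ) : P1Q.act iotaMat (P1Q.ofRat r) = P1Q.ofRat (-r) := by
  rw [P1Q.ofRat, P1Q.act_mk det_iotaMat_ne_zero]
  have hv : P1Q.ratMat iotaMat *ᵥ ![r, 1] = ![-r, 1] := by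
    funext i
    fin_cases i <;> simp [Matrix.mulVec, dotProduct, Fin.sum_univ_two, iotaMat]
  refine (P1Q.mk_eq_ofRat _ (by rw [hv]; simp)).trans ?_
  simp only [hv, Matrix.cons_val_zero, Matrix.cons_val_one, Matrix.cons_val_fin_one, div_one, P1Q.ofRat]

end Literature.NumberTheory.EllipticCurves

end
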